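import Mathlib
import HarnessLib

/-!
# N1 ▸ `node_N1_move` ▸ (d) N1-mono (the deep-belt monodromy model), brick J1-(d6):
# THE TRANSVERSAL FIELD IN FLAT BELT COORDINATES — interpolating the belt gradient field and a pushed field
(wave 8, crux stmt-SmoothPoincare4-10508, line `modp-braid-orbits`, registered stub `stub_M2geo` (N1) ▸
`node_N1_move` ▸ sub-node (d) = H4's `helper_N1_beltMonodromy`; piece (d6) of `work/stubs/H4-REPORT.md` §4;
registered sub-goal `helper_beltTransversalField`)

The analytic model layer of the two-sided fibred belt chart (d) lives in FLAT BELT COORDINATES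
`x = (u, m) ∈ ℝ × ℝ²` of the belt solid torus of a handle (H4-3's belt chart `B (u, m)`, `1`-periodic in `u`).
There the pages of `∂X` are the levels of a `1`-periodic LEVEL FUNCTION `Q` (H4-4/H4-7: `Q = arctan ∘ Sl`,
`Sl` the belt slope) whose FIBRE derivative `∂_m Q` does not vanish on a belt `ℝ × ball 0 ρ₀`, and the chart
structure of the seam (H4-8's seam-lift chart `Λ₀` read in belt coordinates) is a `1`-periodic field `W` on a
shell `ρ₁ < ‖m‖ < ρ₀` with `dQ (W) = 1` (the push-forward of `∂_σ`).  This file proves piece (d6): for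
prescribed radii `ρ₁ < ρ₂ < ρ₃ < ρ₀` there is ONE GLOBAL smooth, complete (globally Lipschitz and bounded),
`1`-periodic field

    V := χ₂ (‖m‖) · ( χ₁ (‖m‖) · ∇_m Q / ‖∇_m Q‖² + (1 − χ₁ (‖m‖)) · W )

with `dQ (V) = 1` on `‖m‖ ≤ ρ₃` (both summands have `dQ = 1`), `V = W` on `ρ₂ ≤ ‖m‖ ≤ ρ₃` and `V = 0` for
`‖m‖ ≥ ρ₀`; its complete flow (`Literature.Analysis.ODE.globalFlow`, piece (d7)) transports level to level at
unit speed and follows the chart lines off the core zone `‖m‖ < ρ₂`.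

Everything is proved; no definitions, no named facts, no `sorry`.  References: J. M. Lee, *Introduction to
Smooth Manifolds*, 2nd ed. (2012), Thm. 9.16, Lemma 2.26 (gluing by partitions of unity) [LeeSmoothManifolds2013];
R. E. Gompf, A. I. Stipsicz, *4-Manifolds and Kirby Calculus* (1999), §8.2 [GompfStipsicz1999].
-/

noncomputable section

set_option linter.dupNamespace false

open scoped Manifold ContDiff Topology NNReal
open Set Function Metric Filter

namespace Summit.SmoothPoincare4.SmoothPoincare4.Theorems.AcyclicBisectionExists.ModpBraidOrbits

namespace BeltField

/-! ## §1 Flat calculus on `ℝ × ℝ²`: fibre gradient, periodicity of derivatives -/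

/-- A vector of `ℝ²` is the combination of the two standard basis vectors with its coordinates. [folklore] -/
theorem eq_sum_single (v : EuclideanSpace ℝ (Fin 2)) :
    v = v 0 • EuclideanSpace.single (0 : Fin 2) (1 : ℝ) + v 1 • EuclideanSpace.single (1 : Fin 2) (1 : ℝ) := by
  ext i; fin_cases i <;> simp

/-- **The Riesz vector of a functional on `ℝ²` in the standard basis**: `⟪∑ L(eᵢ) eᵢ, v⟫ = L v`.
[folklore] -/
theorem inner_rieszVec (L : EuclideanSpace ℝ (Fin 2) →L[ℝ] ℝ) (v : EuclideanSpace ℝ (Fin 2)) :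
    inner ℝ (L (EuclideanSpace.single (0 : Fin 2) (1 : ℝ)) • EuclideanSpace.single (0 : Fin 2) (1 : ℝ) +
      L (EuclideanSpace.single (1 : Fin 2) (1 : ℝ)) • EuclideanSpace.single (1 : Fin 2) (1 : ℝ)) v = L v := by
  conv_rhs => rw [eq_sum_single v]
  simp only [inner_add_left, real_inner_smul_left, EuclideanSpace.inner_single_left, map_add, map_smul,
    smul_eq_mul]
  simp; ring

/-- The Riesz vector of a non-zero functional is non-zero. [folklore] -/
theorem rieszVec_ne_zero {L : EuclideanSpace ℝ (Fin 2) →L[ℝ] ℝ} (hL : L ≠ 0) :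
    L (EuclideanSpace.single (0 : Fin 2) (1 : ℝ)) • EuclideanSpace.single (0 : Fin 2) (1 : ℝ) +
      L (EuclideanSpace.single (1 : Fin 2) (1 : ℝ)) • EuclideanSpace.single (1 : Fin 2) (1 : ℝ) ≠ 0 := by
  intro h0
  apply hL
  ext v
  rw [← inner_rieszVec L v, h0, inner_zero_left]; rfl

/-- **The derivative of a `1`-periodic function is `1`-periodic.** [folklore] -/
theorem fderiv_periodic {F : Type*} [NormedAddCommGroup F] [NormedSpace ℝ F]
    {f : ℝ × EuclideanSpace ℝ (Fin 2) → F} (hf : ∀ u m, f (u + 1, m) = f (u, m))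
    (u : ℝ) (m : EuclideanSpace ℝ (Fin 2)) : fderiv ℝ f (u + 1, m) = fderiv ℝ f (u, m) := by
  have e : (fun y : ℝ × EuclideanSpace ℝ (Fin 2) => f (y + ((1 : ℝ), (0 : EuclideanSpace ℝ (Fin 2))))) = f := by
    funext y
    obtain ⟨u', m'⟩ := y
    show f (u' + 1, m' + 0) = f (u', m')
    rw [add_zero, hf]
  have h : fderiv ℝ (fun y : ℝ × EuclideanSpace ℝ (Fin 2) => f (y + ((1 : ℝ), (0 : EuclideanSpace ℝ (Fin 2))))) (u, m) =
      fderiv ℝ f ((u, m) + ((1 : ℝ), (0 : EuclideanSpace ℝ (Fin 2)))) := fderiv_comp_add_right _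
  rw [e] at h
  rw [h, Prod.mk_add_mk, add_zero]

/-- **The fibre partial derivative is the full derivative composed with `inr`.** [folklore] -/
theorem fderiv_fibre_eq {Q : ℝ × EuclideanSpace ℝ (Fin 2) → ℝ} {p : ℝ × EuclideanSpace ℝ (Fin 2)}
    (hQ : DifferentiableAt ℝ Q p) :
    fderiv ℝ (fun m' : EuclideanSpace ℝ (Fin 2) => Q (p.1, m')) p.2 =
      (fderiv ℝ Q p).comp (ContinuousLinearMap.inr ℝ ℝ (EuclideanSpace ℝ (Fin 2))) :=
  (hQ.hasFDerivAt.comp p.2 (hasFDerivAt_prodMk_right p.1 p.2)).fderiv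

/-- **A continuous `1`-periodic function vanishing for `‖m‖ ≥ ρ₀` is bounded.** [folklore] -/
theorem exists_bound_of_periodic {F : Type*} [NormedAddCommGroup F]
    {f : ℝ × EuclideanSpace ℝ (Fin 2) → F} (hf : Continuous f) (h1 : ∀ u m, f (u + 1, m) = f (u, m))
    {ρ₀ : ℝ} (h0 : ∀ u m, ρ₀ ≤ ‖m‖ → f (u, m) = 0) : ∃ C : ℝ, 0 ≤ C ∧ ∀ p, ‖f p‖ ≤ C := by
  obtain ⟨C, hC⟩ := (isCompact_Icc.prod (isCompact_closedBall (0 : EuclideanSpace ℝ (Fin 2)) ρ₀)).exists_bound_of_continuousOn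
    (s := Icc (0 : ℝ) 1 ×ˢ closedBall (0 : EuclideanSpace ℝ (Fin 2)) ρ₀) hf.continuousOn
  refine ⟨max C 0, le_max_right _ _, fun p => ?_⟩
  obtain ⟨u, m⟩ := p
  by_cases hm : ρ₀ ≤ ‖m‖
  · rw [h0 u m hm, norm_zero]; exact le_max_right _ _
  · have hper : Function.Periodic (fun u => f (u, m)) 1 := fun u => h1 u m
    have e : f (Int.fract u, m) = f (u, m) := by
      have h := (hper.int_mul (-⌊u⌋)) u
      simp only [Int.cast_neg, mul_one] at h
      rw [Int.fract, sub_eq_add_neg]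
      exact h
    rw [← e]
    refine le_trans (hC _ ⟨⟨Int.fract_nonneg u, (Int.fract_lt_one u).le⟩, ?_⟩) (le_max_left _ _)
    exact mem_closedBall_zero_iff.2 (not_le.1 hm).le

end BeltField

open BeltField

/-! ## §2 The transversal field -/

/-- **Sub-goal `helper_beltTransversalField` of stub `stub_M2geo`** (N1 ▸ `node_N1_move` ▸ (d) N1-mono, piece (d6);
wave 8, lead c5).  THE TRANSVERSAL FIELD IN FLAT BELT COORDINATES `(u, m) ∈ ℝ × ℝ²`: given a `1`-periodic level
function `Q`, smooth with non-vanishing fibre derivative on the belt `ℝ × ball 0 ρ₀`, and a `1`-periodic field `W`,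
smooth with `dQ (W) = 1` on the shell `ρ₁ < ‖m‖ < ρ₀`, and prescribed radii `ρ₁ < ρ₂ < ρ₃ < ρ₀`, there is a GLOBAL
smooth, globally Lipschitz, bounded, `1`-periodic field `V` on `ℝ × ℝ²` with `dQ (V) = 1` on `‖m‖ ≤ ρ₃`, `V = W` on
`ρ₂ ≤ ‖m‖ ≤ ρ₃` and `V = 0` for `‖m‖ ≥ ρ₀` (the interpolation `χ₂ (χ₁ ∇_m Q/‖∇_m Q‖² + (1 − χ₁) W)` by radial
bump functions). [cite: LeeSmoothManifolds2013, Lemma 2.26 and Thm. 9.16] -/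
theorem helper_beltTransversalField : ∀ (Q : ℝ × EuclideanSpace ℝ (Fin 2) → ℝ) (W : ℝ × EuclideanSpace ℝ (Fin 2) → ℝ × EuclideanSpace ℝ (Fin 2)) (ρ₀ ρ₁ ρ₂ ρ₃ : ℝ), 0 < ρ₁ → ρ₁ < ρ₂ → ρ₂ < ρ₃ → ρ₃ < ρ₀ → ContDiffOn ℝ ∞ Q (Set.univ ×ˢ Metric.ball (0 : EuclideanSpace ℝ (Fin 2)) ρ₀) → (∀ (u : ℝ) (m : EuclideanSpace ℝ (Fin 2)), Q (u + 1, m) = Q (u, m)) → (∀ (u : ℝ) (m : EuclideanSpace ℝ (Fin 2)), ‖m‖ < ρ₀ → fderiv ℝ (fun m' : EuclideanSpace ℝ (Fin 2) => Q (u, m')) m ≠ 0) → ContDiffOn ℝ ∞ W (Set.univ ×ˢ (Metric.ball (0 : EuclideanSpace ℝ (Fin 2)) ρ₀ \ Metric.closedBall (0 : EuclideanSpace ℝ (Fin 2)) ρ₁)) → (∀ (u : ℝ) (m : EuclideanSpace ℝ (Fin 2)), W (u + 1, m) = W (u, m)) → (∀ (u : ℝ) (m : EuclideanSpace ℝ (Fin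 2)), ρ₁ < ‖m‖ → ‖m‖ < ρ₀ → fderiv ℝ Q (u, m) (W (u, m)) = 1) → ∃ (V : ℝ × EuclideanSpace ℝ (Fin 2) → ℝ × EuclideanSpace ℝ (Fin 2)) (K : NNReal) (L : ℝ), ContDiff ℝ ∞ V ∧ LipschitzWith K V ∧ (∀ p, ‖V p‖ ≤ L) ∧ (∀ (u : ℝ) (m : EuclideanSpace ℝ (Fin 2)), V (u + 1, m) = V (u, m)) ∧ (∀ (u : ℝ) (m : EuclideanSpace ℝ (Fin 2)), ‖m‖ ≤ ρ₃ → fderiv ℝ Q (u, m) (V (u, m)) = 1) ∧ (∀ (u : ℝ) (m : EuclideanSpace ℝ (Fin 2)), ρ₂ ≤ ‖m‖ → ‖m‖ ≤ ρ₃ → V (u, m) = W (u, m)) ∧ (∀ (u : ℝ) (m : EuclideanSpace ℝ (Fin 2)), ρ₀ ≤ ‖m‖ → V (u, m) = 0) := by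
  intro Q W ρ₀ ρ₁ ρ₂ ρ₃ hρ₁ h12 h23 h30 hQ hQ1 hQm hW hW1 hWQ
  -- the open belt and differentiability of `Q` there
  set U : Set (ℝ × EuclideanSpace ℝ (Fin 2)) := (univ : Set ℝ) ×ˢ ball (0 : EuclideanSpace ℝ (Fin 2)) ρ₀ with hU
  have hUo : IsOpen U := isOpen_univ.prod isOpen_ball
  have hmemU : ∀ {u : ℝ} {m : EuclideanSpace ℝ (Fin 2)}, ‖m‖ < ρ₀ → ((u, m) : ℝ × EuclideanSpace ℝ (Fin 2)) ∈ U :=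
    fun hm => ⟨mem_univ _, mem_ball_zero_iff.2 hm⟩
  have hQd : ∀ p ∈ U, DifferentiableAt ℝ Q p := fun p hp =>
    (hQ.differentiableOn (by simp)).differentiableAt (hUo.mem_nhds hp)
  have hQf : ContDiffOn ℝ ∞ (fderiv ℝ Q) U := hQ.fderiv_of_isOpen hUo (by simp)
  -- the fibre functional `Lm p := (fderiv Q p) ∘ inr` and its Riesz vector `grad p`
  obtain ⟨grad, hgrad⟩ : ∃ grad : ℝ × EuclideanSpace ℝ (Fin 2) → EuclideanSpace ℝ (Fin 2), ∀ p, grad p =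
      ((fderiv ℝ Q p).comp (ContinuousLinearMap.inr ℝ ℝ (EuclideanSpace ℝ (Fin 2)))) (EuclideanSpace.single (0 : Fin 2) (1 : ℝ)) •
          EuclideanSpace.single (0 : Fin 2) (1 : ℝ) +
        ((fderiv ℝ Q p).comp (ContinuousLinearMap.inr ℝ ℝ (EuclideanSpace ℝ (Fin 2)))) (EuclideanSpace.single (1 : Fin 2) (1 : ℝ)) •
          EuclideanSpace.single (1 : Fin 2) (1 : ℝ) := ⟨_, fun _ => rfl⟩
  have hgrad_inner : ∀ p (v : EuclideanSpace ℝ (Fin 2)), inner ℝ (grad p) v = fderiv ℝ Q p ((0 : ℝ), v) := by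
    intro p v
    rw [hgrad, inner_rieszVec]
    rfl
  have hgrad_ne : ∀ p ∈ U, grad p ≠ 0 := by
    rintro ⟨u, m⟩ hp
    rw [hgrad]
    apply rieszVec_ne_zero
    rw [← fderiv_fibre_eq (hQd _ hp)]
    exact hQm u m (mem_ball_zero_iff.1 hp.2)
  have hgrad_s : ContDiffOn ℝ ∞ grad U := by
    have e : grad = fun p => ((fderiv ℝ Q p).comp (ContinuousLinearMap.inr ℝ ℝ (EuclideanSpace ℝ (Fin 2))))
        (EuclideanSpace.single (0 : Fin 2) (1 : ℝ)) • EuclideanSpace.single (0 : Fin 2) (1 : ℝ) +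
        ((fderiv ℝ Q p).comp (ContinuousLinearMap.inr ℝ ℝ (EuclideanSpace ℝ (Fin 2)))) (EuclideanSpace.single (1 : Fin 2) (1 : ℝ)) •
          EuclideanSpace.single (1 : Fin 2) (1 : ℝ) := funext hgrad
    rw [e]
    have hc : ContDiffOn ℝ ∞ (fun p => (fderiv ℝ Q p).comp (ContinuousLinearMap.inr ℝ ℝ (EuclideanSpace ℝ (Fin 2)))) U :=
      hQf.clm_comp contDiffOn_const
    exact ((hc.clm_apply contDiffOn_const).smul contDiffOn_const).add ((hc.clm_apply contDiffOn_const).smul contDiffOn_const)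
  have hgrad1 : ∀ u m, grad (u + 1, m) = grad (u, m) := fun u m => by rw [hgrad, hgrad, fderiv_periodic hQ1]
  -- the belt gradient field `V₁ := (0, grad/‖grad‖²)` with `dQ (V₁) = 1`
  obtain ⟨V₁, hV₁⟩ : ∃ V₁ : ℝ × EuclideanSpace ℝ (Fin 2) → ℝ × EuclideanSpace ℝ (Fin 2), ∀ p,
      V₁ p = ((0 : ℝ), (‖grad p‖ ^ 2)⁻¹ • grad p) := ⟨_, fun _ => rfl⟩
  have hV₁Q : ∀ p ∈ U, fderiv ℝ Q p (V₁ p) = 1 := by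
    intro p hp
    rw [hV₁, ← hgrad_inner, real_inner_smul_right, real_inner_self_eq_norm_sq]
    exact inv_mul_cancel₀ (pow_ne_zero 2 (norm_ne_zero_iff.2 (hgrad_ne p hp)))
  have hV₁s : ContDiffOn ℝ ∞ V₁ U := by
    have e : V₁ = fun p => ((0 : ℝ), (‖grad p‖ ^ 2)⁻¹ • grad p) := funext hV₁
    rw [e]
    have hns : ContDiffOn ℝ ∞ (fun p => (‖grad p‖ ^ 2)⁻¹) U :=
      (hgrad_s.norm_sq ℝ).inv fun p hp => pow_ne_zero 2 (norm_ne_zero_iff.2 (hgrad_ne p hp))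
    exact contDiffOn_const.prodMk (hns.smul hgrad_s)
  have hV₁1 : ∀ u m, V₁ (u + 1, m) = V₁ (u, m) := fun u m => by rw [hV₁, hV₁, hgrad1]
  -- the two radial bumps
  set χ₁ : ContDiffBump (0 : EuclideanSpace ℝ (Fin 2)) := ⟨(ρ₁ + ρ₂) / 2, ρ₂, by linarith, by linarith⟩ with hχ₁
  set χ₂ : ContDiffBump (0 : EuclideanSpace ℝ (Fin 2)) := ⟨ρ₃, (ρ₃ + ρ₀) / 2, by linarith, by linarith⟩ with hχ₂
  have hχ₁one : ∀ m : EuclideanSpace ℝ (Fin 2), ‖m‖ ≤ (ρ₁ + ρ₂) / 2 → χ₁ m = 1 := fun m hm =>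
    χ₁.one_of_mem_closedBall (mem_closedBall_zero_iff.2 hm)
  have hχ₁zero : ∀ m : EuclideanSpace ℝ (Fin 2), ρ₂ ≤ ‖m‖ → χ₁ m = 0 := fun m hm =>
    χ₁.zero_of_le_dist (by rw [dist_zero_right]; exact hm)
  have hχ₂one : ∀ m : EuclideanSpace ℝ (Fin 2), ‖m‖ ≤ ρ₃ → χ₂ m = 1 := fun m hm =>
    χ₂.one_of_mem_closedBall (mem_closedBall_zero_iff.2 hm)
  have hχ₂zero : ∀ m : EuclideanSpace ℝ (Fin 2), (ρ₃ + ρ₀) / 2 ≤ ‖m‖ → χ₂ m = 0 := fun m hm =>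
    χ₂.zero_of_le_dist (by rw [dist_zero_right]; exact hm)
  -- THE FIELD
  obtain ⟨V, hV⟩ : ∃ V : ℝ × EuclideanSpace ℝ (Fin 2) → ℝ × EuclideanSpace ℝ (Fin 2), ∀ p,
      V p = χ₂ p.2 • (χ₁ p.2 • V₁ p + (1 - χ₁ p.2) • W p) := ⟨_, fun _ => rfl⟩
  have hVe : V = fun p => χ₂ p.2 • (χ₁ p.2 • V₁ p + (1 - χ₁ p.2) • W p) := funext hV
  -- `V = 0` for `‖m‖ ≥ (ρ₃ + ρ₀)/2`, `V = χ₂ V₁` for `‖m‖ ≤ (ρ₁ + ρ₂)/2`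
  have hVzero : ∀ u m, (ρ₃ + ρ₀) / 2 ≤ ‖m‖ → V (u, m) = 0 := fun u m hm => by
    rw [hV]; show χ₂ m • _ = 0; rw [hχ₂zero m hm, zero_smul]
  have hVcore : ∀ u m, ‖m‖ ≤ (ρ₁ + ρ₂) / 2 → V (u, m) = χ₂ m • V₁ (u, m) := fun u m hm => by
    rw [hV]; show χ₂ m • (χ₁ m • _ + (1 - χ₁ m) • _) = _; rw [hχ₁one m hm]; simp
  -- SMOOTHNESS
  have hVs : ContDiff ℝ ∞ V := by
    rw [contDiff_iff_contDiffAt]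
    rintro ⟨u, m⟩
    have hχ₁s : ContDiffAt ℝ ∞ (fun p : ℝ × EuclideanSpace ℝ (Fin 2) => χ₁ p.2) (u, m) :=
      (χ₁.contDiff.comp contDiff_snd).contDiffAt
    have hχ₂s : ContDiffAt ℝ ∞ (fun p : ℝ × EuclideanSpace ℝ (Fin 2) => χ₂ p.2) (u, m) :=
      (χ₂.contDiff.comp contDiff_snd).contDiffAt
    rcases le_or_gt ρ₀ ‖m‖ with hm | hm
    · -- far out: `V = 0` near `(u, m)`
      have hev : V =ᶠ[𝓝 ((u, m) : ℝ × EuclideanSpace ℝ (Fin 2))] fun _ => 0 := by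
        have ho : IsOpen {p : ℝ × EuclideanSpace ℝ (Fin 2) | (ρ₃ + ρ₀) / 2 < ‖p.2‖} :=
          isOpen_lt continuous_const (continuous_norm.comp continuous_snd)
        filter_upwards [ho.mem_nhds (show (ρ₃ + ρ₀) / 2 < ‖m‖ by linarith)] with p hp
        exact hVzero p.1 p.2 (le_of_lt hp)
      exact (contDiffAt_const (c := (0 : ℝ × EuclideanSpace ℝ (Fin 2)))).congr_of_eventuallyEq hev
    · have hpU : ((u, m) : ℝ × EuclideanSpace ℝ (Fin 2)) ∈ U := hmemU hm
      have hV₁a : ContDiffAt ℝ ∞ V₁ (u, m) := hV₁s.contDiffAt (hUo.mem_nhds hpU)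
      rcases le_or_gt ‖m‖ ρ₁ with hm1 | hm1
      · -- core: `V = χ₂ V₁` near `(u, m)`
        have hev : V =ᶠ[𝓝 ((u, m) : ℝ × EuclideanSpace ℝ (Fin 2))] fun p => χ₂ p.2 • V₁ p := by
          have ho : IsOpen {p : ℝ × EuclideanSpace ℝ (Fin 2) | ‖p.2‖ < (ρ₁ + ρ₂) / 2} :=
            isOpen_lt (continuous_norm.comp continuous_snd) continuous_const
          filter_upwards [ho.mem_nhds (show ‖m‖ < (ρ₁ + ρ₂) / 2 by linarith)] with p hp
          exact hVcore p.1 p.2 hp.le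
        exact (hχ₂s.smul hV₁a).congr_of_eventuallyEq hev
      · -- shell: all summands are smooth at `(u, m)`
        have hWa : ContDiffAt ℝ ∞ W (u, m) := by
          have ho : IsOpen ((univ : Set ℝ) ×ˢ (ball (0 : EuclideanSpace ℝ (Fin 2)) ρ₀ \ closedBall 0 ρ₁)) :=
            isOpen_univ.prod (isOpen_ball.sdiff isClosed_closedBall)
          exact hW.contDiffAt (ho.mem_nhds ⟨mem_univ _, mem_ball_zero_iff.2 hm, fun h => by
            have := mem_closedBall_zero_iff.1 h; linarith⟩)
        rw [hVe]
        exact hχ₂s.smul ((hχ₁s.smul hV₁a).add ((contDiffAt_const.sub hχ₁s).smul hWa))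
  -- PERIODICITY
  have hVper : ∀ u m, V (u + 1, m) = V (u, m) := fun u m => by
    rw [hV, hV]; show χ₂ m • (χ₁ m • V₁ (u + 1, m) + (1 - χ₁ m) • W (u + 1, m)) = χ₂ m • (χ₁ m • V₁ (u, m) + (1 - χ₁ m) • W (u, m))
    rw [hV₁1, hW1]
  -- `dQ (V) = 1` on `‖m‖ ≤ ρ₃`
  have hVQ : ∀ u m, ‖m‖ ≤ ρ₃ → fderiv ℝ Q (u, m) (V (u, m)) = 1 := by
    intro u m hm
    have hpU : ((u, m) : ℝ × EuclideanSpace ℝ (Fin 2)) ∈ U := hmemU (by linarith)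
    rw [hV]
    show fderiv ℝ Q (u, m) (χ₂ m • (χ₁ m • V₁ (u, m) + (1 - χ₁ m) • W (u, m))) = 1
    rw [hχ₂one m hm, one_smul, map_add, map_smul, map_smul, hV₁Q _ hpU, smul_eq_mul, smul_eq_mul, mul_one]
    rcases le_or_gt ‖m‖ ρ₁ with hm1 | hm1
    · rw [hχ₁one m (by linarith)]; ring
    · rw [hWQ u m hm1 (by linarith)]; ring
  -- `V = W` on `ρ₂ ≤ ‖m‖ ≤ ρ₃`
  have hVW : ∀ u m, ρ₂ ≤ ‖m‖ → ‖m‖ ≤ ρ₃ → V (u, m) = W (u, m) := fun u m h2 h3 => by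
    rw [hV]; show χ₂ m • (χ₁ m • V₁ (u, m) + (1 - χ₁ m) • W (u, m)) = W (u, m)
    rw [hχ₂one m h3, hχ₁zero m h2]; simp
  have hV0 : ∀ u m, ρ₀ ≤ ‖m‖ → V (u, m) = 0 := fun u m hm => hVzero u m (by linarith)
  -- BOUNDEDNESS and LIPSCHITZ (periodicity + vanishing far out + continuity of `V`, `fderiv V`)
  obtain ⟨L, -, hL⟩ := exists_bound_of_periodic hVs.continuous hVper hV0
  have hfd1 : ∀ u m, fderiv ℝ V (u + 1, m) = fderiv ℝ V (u, m) := fderiv_periodic hVper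
  have hfd0 : ∀ u m, ρ₀ ≤ ‖m‖ → fderiv ℝ V (u, m) = 0 := by
    intro u m hm
    have hev : V =ᶠ[𝓝 ((u, m) : ℝ × EuclideanSpace ℝ (Fin 2))] fun _ => 0 := by
      have ho : IsOpen {p : ℝ × EuclideanSpace ℝ (Fin 2) | (ρ₃ + ρ₀) / 2 < ‖p.2‖} :=
        isOpen_lt continuous_const (continuous_norm.comp continuous_snd)
      filter_upwards [ho.mem_nhds (show (ρ₃ + ρ₀) / 2 < ‖m‖ by linarith)] with p hp
      exact hVzero p.1 p.2 (le_of_lt hp)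
    rw [hev.fderiv_eq]
    exact fderiv_const_apply _
  obtain ⟨C, hC0, hC⟩ := exists_bound_of_periodic (hVs.continuous_fderiv (by simp)) hfd1 hfd0
  have hLip : LipschitzWith (Real.toNNReal C) V := by
    refine lipschitzWith_of_nnnorm_fderiv_le (hVs.differentiable (by simp)) fun p => ?_
    have h := hC p
    rw [← NNReal.coe_le_coe, coe_nnnorm, Real.coe_toNNReal C hC0]
    exact h
  exact ⟨V, Real.toNNReal C, L, hVs, hLip, hL, hVper, hVQ, hVW, hV0⟩

end Summit.SmoothPoincare4.SmoothPoincare4.Theorems.AcyclicBisectionExists.ModpBraidOrbits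

end
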